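import Mathlib
import HarnessLib

/-!
# Route `SwapVirialDeficit` (YangMills): SMEARING IDENTITY — a patch-free substitute for tiling in the slab ∕ shell comparison of the core stubs of skeleton ➎
# (LEAD memo10e for `stub_core_end` ∕ `stub_core_tip`; cell ym-idea-1, LEAD g99 free hands, 2026-08-31)

memo10c compares the thin slab with its adjacent bulk shell PATCHWISE in the stratum-A letters `p₀ = (x₀, y₀)` (fibrewise the ratio blows up at Σ).  Instead of
tiling `ℝⁿ` into cubes (countable bookkeeping) one SMEARS with a ball kernel: for an additive Haar measure `μ` on a finite-dimensional real normed space `P` and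
every measurable `f ≥ 0`,
  `μ(B_r) · ∫⁻ f dμ = ∫⁻ p', (∫⁻ p in ball p' r, f p dμ) dμ(p')`   (★ `lintegral_ball_smear`, Tonelli + translation invariance of the ball volume),
and the same with an extra σ-finite factor `X` carried along (★★ `lintegral_prod_ball_smear`: `μ(B_r)·∫⁻ f d(ν ⊗ μ) = ∫⁻ p', ∫⁻ (x,p) in univ ×ˢ ball p' r, f d(ν ⊗ μ) dμ(p')`).
So `slab weight = (μ B_r)⁻¹ ∫ dp' [slab weight of the ball patch around p']`, and it suffices to compare, POINTWISE in `p'`, the ball-patch slab weight with the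
shell weight density at `p'` (memo10c's two computations: `≍ √τ·log(1/τ)/r²·…` at Σ against `≍ 1/√τ`, `≍ 2√τ/|p'|²` against `≍ r_m/|p'|²` away from Σ), the follower
determinant being matched inside the ball (radius `r ≤ r_m/3`).

HONEST LABEL: measure-theoretic identity only; `stub_core_end`, `stub_core_tip`, `stub_B_stiff`, `stub_h001_good`, ⟨24197⟩ ∕ ⟨24194⟩ OPEN; own crux ⟨22884⟩
`LargeFieldMassRefinementTail` OPEN (blocked-on ⟨19935⟩); the Yang–Mills mass gap is NOT proved; no summit is proved by a line.  No instance, no notation,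
no definition, 0 `sorry`, standard axioms.  `--supports stmt-QuantumFields-24197`.
References: [folklore].
-/

set_option autoImplicit false

noncomputable section

open MeasureTheory Set Metric
open scoped ENNReal

namespace Summit.QuantumFields.YangMills.Theorems.SwapVirialDeficit.SectorLaplace

variable {P : Type*} [NormedAddCommGroup P] [NormedSpace ℝ P] [FiniteDimensional ℝ P] [MeasurableSpace P] [BorelSpace P]
  (μ : Measure P) [μ.IsAddHaarMeasure]

/-- The ball indicator is jointly measurable: `{(p', p) | p ∈ ball p' r}` is measurable. [folklore] -/
theorem measurableSet_ball_rel (r : ℝ) : MeasurableSet {q : P × P | q.2 ∈ ball q.1 r} := by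
  have : {q : P × P | q.2 ∈ ball q.1 r} = {q : P × P | dist q.2 q.1 < r} := by ext q; simp [mem_ball]
  rw [this]
  exact measurableSet_lt (measurable_snd.dist measurable_fst) measurable_const

omit [NormedSpace ℝ P] [FiniteDimensional ℝ P] in
/-- The ball volume does not depend on the centre, read through the symmetric relation: `μ {p' | p ∈ ball p' r} = μ (ball 0 r)`. [folklore] -/
theorem measure_ball_centres (r : ℝ) (p : P) : μ {p' : P | p ∈ ball p' r} = μ (ball (0 : P) r) := by
  have : {p' : P | p ∈ ball p' r} = ball p r := by ext p'; simp [mem_ball, dist_comm]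
  rw [this, Measure.addHaar_ball_center]

/-- ★ **SMEARING IDENTITY**: `μ(B_r) · ∫⁻ f dμ = ∫⁻ p', ∫⁻ p in ball p' r, f p dμ dμ(p')` for measurable `f ≥ 0`. [folklore] -/
theorem lintegral_ball_smear (r : ℝ) (f : P → ℝ≥0∞) (hf : Measurable f) :
    μ (ball (0 : P) r) * ∫⁻ p, f p ∂μ = ∫⁻ p', ∫⁻ p in ball p' r, f p ∂μ ∂μ := by
  have hF : Measurable fun q : P × P => ({q : P × P | q.2 ∈ ball q.1 r}).indicator (fun q => f q.2) q :=
    (hf.comp measurable_snd).indicator (measurableSet_ball_rel r)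
  calc μ (ball (0 : P) r) * ∫⁻ p, f p ∂μ = ∫⁻ p, f p * μ (ball (0 : P) r) ∂μ := by
        rw [lintegral_mul_const _ hf, mul_comm]
    _ = ∫⁻ p, ∫⁻ p', ({q : P × P | q.2 ∈ ball q.1 r}).indicator (fun q => f q.2) (p', p) ∂μ ∂μ := by
        refine lintegral_congr fun p => ?_
        have hind : (fun p' => ({q : P × P | q.2 ∈ ball q.1 r}).indicator (fun q => f q.2) (p', p)) =
            ({p' : P | p ∈ ball p' r}).indicator (fun _ => f p) := by
          funext p'
          by_cases h : p ∈ ball p' r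
          · rw [indicator_of_mem (show (p', p) ∈ {q : P × P | q.2 ∈ ball q.1 r} from h),
              indicator_of_mem (show p' ∈ {p' : P | p ∈ ball p' r} from h)]
          · rw [indicator_of_notMem (show (p', p) ∉ {q : P × P | q.2 ∈ ball q.1 r} from h),
              indicator_of_notMem (show p' ∉ {p' : P | p ∈ ball p' r} from h)]
        have hms : MeasurableSet {p' : P | p ∈ ball p' r} := by
          have : {p' : P | p ∈ ball p' r} = ball p r := by ext p'; simp [mem_ball, dist_comm]
          rw [this]; exact measurableSet_ball
        rw [hind, lintegral_indicator hms, setLIntegral_const, measure_ball_centres μ r p]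
    _ = ∫⁻ p', ∫⁻ p, ({q : P × P | q.2 ∈ ball q.1 r}).indicator (fun q => f q.2) (p', p) ∂μ ∂μ :=
        lintegral_lintegral_swap (hF.comp measurable_swap).aemeasurable
    _ = ∫⁻ p', ∫⁻ p in ball p' r, f p ∂μ ∂μ := by
        refine lintegral_congr fun p' => ?_
        rw [← lintegral_indicator measurableSet_ball]
        refine lintegral_congr fun p => ?_
        by_cases h : p ∈ ball p' r
        · rw [indicator_of_mem (show (p', p) ∈ {q : P × P | q.2 ∈ ball q.1 r} from h), indicator_of_mem h]
        · rw [indicator_of_notMem (show (p', p) ∉ {q : P × P | q.2 ∈ ball q.1 r} from h), indicator_of_notMem h]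

/-- ★★ **SMEARING WITH A CARRIED FACTOR**: for a σ-finite `ν` on `X` and measurable `f ≥ 0` on `X × P`,
`μ(B_r) · ∫⁻ f d(ν ⊗ μ) = ∫⁻ p', ∫⁻ q in univ ×ˢ ball p' r, f q d(ν ⊗ μ) dμ(p')` — the slab weight is the ball-average of its patch weights. [folklore] -/
theorem lintegral_prod_ball_smear {X : Type*} [MeasurableSpace X] (ν : Measure X) [SFinite ν] (r : ℝ) (f : X × P → ℝ≥0∞) (hf : Measurable f) :
    μ (ball (0 : P) r) * ∫⁻ q, f q ∂(ν.prod μ) = ∫⁻ p', ∫⁻ q in (univ : Set X) ×ˢ ball p' r, f q ∂(ν.prod μ) ∂μ := by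
  -- Tonelli in `q = (x, p)`, smear in `p` for each fixed `x`, and swap back
  have h1 : ∫⁻ q, f q ∂(ν.prod μ) = ∫⁻ x, ∫⁻ p, f (x, p) ∂μ ∂ν := lintegral_prod _ hf.aemeasurable
  rw [h1, ← lintegral_const_mul _ (hf.lintegral_prod_right')]
  have h2 : ∀ x, μ (ball (0 : P) r) * ∫⁻ p, f (x, p) ∂μ = ∫⁻ p', ∫⁻ p in ball p' r, f (x, p) ∂μ ∂μ :=
    fun x => lintegral_ball_smear μ r (fun p => f (x, p)) (hf.comp (measurable_const.prodMk measurable_id))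
  simp_rw [h2]
  -- swap `x` and `p'`
  have hG : Measurable fun q : X × P => ∫⁻ p in ball q.2 r, f (q.1, p) ∂μ := by
    have hK : Measurable fun z : (X × P) × P => ({z : (X × P) × P | z.2 ∈ ball z.1.2 r}).indicator (fun z => f (z.1.1, z.2)) z := by
      refine (hf.comp (measurable_fst.fst.prodMk measurable_snd)).indicator ?_
      have : {z : (X × P) × P | z.2 ∈ ball z.1.2 r} = {z | dist z.2 z.1.2 < r} := by ext z; simp [mem_ball]
      rw [this]
      exact measurableSet_lt (measurable_snd.dist (measurable_snd.comp measurable_fst)) measurable_const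
    have hrepr : (fun q : X × P => ∫⁻ p in ball q.2 r, f (q.1, p) ∂μ) =
        fun q : X × P => ∫⁻ p, ({z : (X × P) × P | z.2 ∈ ball z.1.2 r}).indicator (fun z => f (z.1.1, z.2)) (q, p) ∂μ := by
      funext q
      rw [← lintegral_indicator measurableSet_ball]
      refine lintegral_congr fun p => ?_
      by_cases h : p ∈ ball q.2 r
      · rw [indicator_of_mem h, indicator_of_mem (show (q, p) ∈ {z : (X × P) × P | z.2 ∈ ball z.1.2 r} from h)]
      · rw [indicator_of_notMem h, indicator_of_notMem (show (q, p) ∉ {z : (X × P) × P | z.2 ∈ ball z.1.2 r} from h)]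
    rw [hrepr]
    exact hK.lintegral_prod_right'
  rw [lintegral_lintegral_swap hG.aemeasurable]
  refine lintegral_congr fun p' => ?_
  rw [← lintegral_indicator (MeasurableSet.univ.prod measurableSet_ball), lintegral_prod _ ((hf.indicator (MeasurableSet.univ.prod measurableSet_ball)).aemeasurable)]
  refine lintegral_congr fun x => ?_
  rw [← lintegral_indicator measurableSet_ball]
  refine lintegral_congr fun p => ?_
  by_cases h : p ∈ ball p' r
  · rw [indicator_of_mem h, indicator_of_mem (show (x, p) ∈ (univ : Set X) ×ˢ ball p' r from ⟨mem_univ _, h⟩)]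
  · rw [indicator_of_notMem h, indicator_of_notMem (show (x, p) ∉ (univ : Set X) ×ˢ ball p' r from fun hh => h hh.2)]

omit [BorelSpace P] in
/-- The ball has positive finite Haar measure (`r > 0`), so the smearing identity can be divided through. [folklore] -/
theorem measure_ball_pos_lt_top {r : ℝ} (hr : 0 < r) : 0 < μ (ball (0 : P) r) ∧ μ (ball (0 : P) r) < ⊤ :=
  ⟨measure_ball_pos μ 0 hr, measure_ball_lt_top⟩

end Summit.QuantumFields.YangMills.Theorems.SwapVirialDeficit.SectorLaplace

end
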